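import Mathlib.NumberTheory.NumberField.Cyclotomic.Galois
import Mathlib.NumberTheory.RamificationInertia.Galois
import Mathlib.RingTheory.Frobenius
import Mathlib.FieldTheory.Finite.GaloisField
import Mathlib.NumberTheory.NumberField.Ideal.Basic

/-!
# Places of an intermediate field of `ℚ(ζ_m)` above a prime `p ∤ m`

Route `PlecticLegs`, support item `ArtinBaseChange` (stmt-BirchSwinnertonDyer-18261): the
Galois-theoretic input of Artin formalism for the abelian field `F = ℚ(ζ_m)^H`. For a prime
`p ∤ m` and a prime `w` of `𝓞 F` above `p`:

* `w` is unramified (`e(w|p) = 1`), since `p` is unramified in `ℚ(ζ_m)` (Mathlib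
  `IsCyclotomicExtension.Rat.ramificationIdx_eq_of_not_dvd`);
* its residue degree `f(w|p)` is the order of `σ_p H` in `Gal(ℚ(ζ_m)/ℚ)/H ≅ Gal(F/ℚ)`, where
  `σ_p(ζ) = ζ^p` is the Frobenius of `p` in `ℚ(ζ_m)`: the restriction of `σ_p` to `F` is an
  arithmetic Frobenius at `w`, and at an unramified prime the order of a Frobenius is the residue
  degree (Neukirch I (9.4); Washington Thm. 2.13);
* hence `#{w ∣ p} · f = [F : ℚ]`.

Proved over the base `ℤ` (Mathlib's cyclotomic decomposition law) and moved to the base `𝓞 ℚ` of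
the tree's Euler-factor files (`ℤ ⊆ 𝓞 ℚ` has `e = f = 1`). References: Washington,
*Introduction to Cyclotomic Fields*, Thm. 2.13 and Ch. 3; Neukirch, *Algebraic Number Theory*, I §9.
-/

noncomputable section

-- D-0017: single-problem summit, so `Summit.BirchSwinnertonDyer.BirchSwinnertonDyer.…` repeats a
-- namespace BY DESIGN.
set_option linter.dupNamespace false

open scoped Classical
open NumberField IsDedekindDomain

namespace Summit.BirchSwinnertonDyer.BirchSwinnertonDyer.Theorems

/-! ## The base rings `ℤ ⊆ 𝓞 ℚ`: `e = f = 1` -/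

section IntBridge

/-- A prime `v` of `𝓞 ℚ` has `e(v | v ∩ ℤ) = f(v | v ∩ ℤ) = 1` and is the only prime of `𝓞 ℚ`
above `v ∩ ℤ` (the degree formula `∑ e f = [𝓞 ℚ : ℤ] = 1`). [folklore] -/
theorem ramificationIdx_inertiaDeg_eq_one_of_rat (v : HeightOneSpectrum (𝓞 ℚ)) :
    v.asIdeal.ramificationIdx ℤ = 1 ∧ v.asIdeal.inertiaDeg ℤ = 1 ∧
      ∀ v' : HeightOneSpectrum (𝓞 ℚ), v'.asIdeal.under ℤ = v.asIdeal.under ℤ → v' = v := by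
  set p₀ : Ideal ℤ := v.asIdeal.under ℤ with hp₀
  haveI : v.asIdeal.IsMaximal := v.isMaximal
  haveI : p₀.IsMaximal := Ideal.IsMaximal.under ℤ v.asIdeal
  have hp₀ne : p₀ ≠ ⊥ := by
    intro h
    exact v.ne_bot (Ideal.eq_bot_of_comap_eq_bot (R := ℤ) h)
  have hsum := Ideal.sum_ramification_inertia_eq_finrank p₀ (𝓞 ℚ)
  rw [RingOfIntegers.rank, Module.finrank_self] at hsum
  have hmem : ∀ v' : HeightOneSpectrum (𝓞 ℚ), v'.asIdeal.under ℤ = p₀ →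
      v'.asIdeal ∈ p₀.primesOver (𝓞 ℚ) := fun v' hv' ↦ ⟨v'.isPrime, ⟨hv'.symm⟩⟩
  have hpos : ∀ q : p₀.primesOver (𝓞 ℚ), 1 ≤ (q : Ideal (𝓞 ℚ)).ramificationIdx ℤ *
      (q : Ideal (𝓞 ℚ)).inertiaDeg ℤ := by
    intro q
    haveI : (q : Ideal (𝓞 ℚ)).IsPrime := q.2.1
    exact Nat.one_le_iff_ne_zero.mpr (Nat.mul_ne_zero (Ideal.ramificationIdx_pos _ _).ne'
      (Ideal.inertiaDeg_pos _ _).ne')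
  -- the sum of terms `≥ 1` over a nonempty finite type is `1`: one term, equal to `1`
  set q₀ : p₀.primesOver (𝓞 ℚ) := ⟨v.asIdeal, hmem v rfl⟩ with hq₀
  have hle : ∀ q : p₀.primesOver (𝓞 ℚ), (q : Ideal (𝓞 ℚ)).ramificationIdx ℤ *
      (q : Ideal (𝓞 ℚ)).inertiaDeg ℤ ≤ 1 := fun q ↦ by
    rw [← hsum]
    exact Finset.single_le_sum (f := fun q : p₀.primesOver (𝓞 ℚ) ↦
      (q : Ideal (𝓞 ℚ)).ramificationIdx ℤ * (q : Ideal (𝓞 ℚ)).inertiaDeg ℤ)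
      (fun q _ ↦ Nat.zero_le _) (Finset.mem_univ q)
  have hone : ∀ q : p₀.primesOver (𝓞 ℚ), (q : Ideal (𝓞 ℚ)).ramificationIdx ℤ *
      (q : Ideal (𝓞 ℚ)).inertiaDeg ℤ = 1 := fun q ↦ le_antisymm (hle q) (hpos q)
  have hcard : Fintype.card (p₀.primesOver (𝓞 ℚ)) = 1 := by
    have h := hsum
    rw [Finset.sum_congr rfl fun q _ ↦ hone q, Finset.sum_const, smul_eq_mul, mul_one,
      Finset.card_univ] at h
    exact h
  have hef := hone q₀
  refine ⟨Nat.eq_one_of_mul_eq_one_right hef, Nat.eq_one_of_mul_eq_one_left hef, fun v' hv' ↦ ?_⟩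
  have hsub : Subsingleton (p₀.primesOver (𝓞 ℚ)) := Fintype.card_le_one_iff_subsingleton.mp hcard.le
  have h := hsub.elim ⟨v'.asIdeal, hmem v' hv'⟩ q₀
  exact HeightOneSpectrum.ext (congrArg Subtype.val h)

variable {L : Type*} [Field L] [NumberField L]

/-- **`f(P | 𝓞 ℚ) = f(P | ℤ)`** for a prime `P` of the ring of integers of a number field: the
residue degree over the base `𝓞 ℚ` (the tree's convention) is the residue degree over `ℤ`
(Mathlib's convention for cyclotomic fields), by the tower `ℤ ⊆ 𝓞 ℚ ⊆ 𝓞 L` and `f = 1` for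
`ℤ ⊆ 𝓞 ℚ`. [folklore] -/
theorem inertiaDeg_ringOfIntegersRat_eq (P : Ideal (𝓞 L)) [P.IsMaximal] :
    P.inertiaDeg (𝓞 ℚ) = P.inertiaDeg ℤ := by
  have hPne : P ≠ ⊥ := Ring.ne_bot_of_isMaximal_of_not_isField inferInstance
    (RingOfIntegers.not_isField L)
  set v : HeightOneSpectrum (𝓞 ℚ) :=
    ⟨P.under (𝓞 ℚ), Ideal.IsPrime.under (𝓞 ℚ) P, Ideal.under_ne_bot (A := 𝓞 ℚ) hPne⟩ with hv
  haveI : P.LiesOver v.asIdeal := ⟨rfl⟩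
  have h := Ideal.inertiaDeg_tower v.asIdeal P (R := ℤ) (S := 𝓞 ℚ) (T := 𝓞 L)
  rw [(ramificationIdx_inertiaDeg_eq_one_of_rat v).2.1, one_mul] at h
  exact h.symm

/-- **`e(P | 𝓞 ℚ) = e(P | ℤ)`** for a prime `P` of the ring of integers of a number field
(tower `ℤ ⊆ 𝓞 ℚ ⊆ 𝓞 L`, `e = 1` for `ℤ ⊆ 𝓞 ℚ`). [folklore] -/
theorem ramificationIdx_ringOfIntegersRat_eq (P : Ideal (𝓞 L)) [P.IsMaximal] :
    P.ramificationIdx (𝓞 ℚ) = P.ramificationIdx ℤ := by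
  have hPne : P ≠ ⊥ := Ring.ne_bot_of_isMaximal_of_not_isField inferInstance
    (RingOfIntegers.not_isField L)
  set v : HeightOneSpectrum (𝓞 ℚ) :=
    ⟨P.under (𝓞 ℚ), Ideal.IsPrime.under (𝓞 ℚ) P, Ideal.under_ne_bot (A := 𝓞 ℚ) hPne⟩ with hv
  haveI : P.LiesOver v.asIdeal := ⟨rfl⟩
  have h := Ideal.ramificationIdx_tower v.asIdeal P (R := ℤ) (S := 𝓞 ℚ) (T := 𝓞 L)
  rw [(ramificationIdx_inertiaDeg_eq_one_of_rat v).1, one_mul] at h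
  exact h.symm

/-- Two finite places of `ℚ` containing the same rational prime are equal. [folklore] -/
theorem HeightOneSpectrum.eq_of_natCast_mem {p : ℕ} (hp : p.Prime) {v v' : HeightOneSpectrum (𝓞 ℚ)}
    (hv : (p : 𝓞 ℚ) ∈ v.asIdeal) (hv' : (p : 𝓞 ℚ) ∈ v'.asIdeal) : v' = v := by
  have key : ∀ w : HeightOneSpectrum (𝓞 ℚ), (p : 𝓞 ℚ) ∈ w.asIdeal →
      w.asIdeal.under ℤ = Ideal.span {(p : ℤ)} := by
    intro w hw
    haveI : w.asIdeal.IsMaximal := w.isMaximal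
    haveI : (Ideal.span {(p : ℤ)}).IsMaximal :=
      ((Ideal.span_singleton_prime (by exact_mod_cast hp.ne_zero)).mpr
        (Nat.prime_iff_prime_int.mp hp)).isMaximal (by simpa using hp.ne_zero)
    refine ((Ideal.IsMaximal.eq_of_le inferInstance (Ideal.IsMaximal.under ℤ w.asIdeal).ne_top
      ?_)).symm
    rw [Ideal.span_singleton_le_iff_mem, Ideal.under_def, Ideal.mem_comap, map_natCast]
    exact hw
  exact (ramificationIdx_inertiaDeg_eq_one_of_rat v).2.2 v' ((key v' hv').trans (key v hv).symm)

end IntBridge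

/-! ## The order of a Frobenius at an unramified prime is the residue degree -/

section FrobeniusOrder

variable {E : Type*} [Field E] [NumberField E]

omit [NumberField E] in
/-- Powers of an arithmetic Frobenius: `τ^k x ≡ x^{q^k} (mod w)`. [folklore] -/
theorem mk_pow_smul_of_isArithFrobAt {G : Type*} [Group G] [MulSemiringAction G (𝓞 E)]
    [SMulCommClass G ℤ (𝓞 E)] {w : Ideal (𝓞 E)} {τ : G} (hτ : IsArithFrobAt ℤ τ w) :
    ∀ (k : ℕ) (x : 𝓞 E), Ideal.Quotient.mk w ((τ ^ k) • x) =
      Ideal.Quotient.mk w x ^ (Nat.card (ℤ ⧸ w.under ℤ)) ^ k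
  | 0, x => by simp
  | k + 1, x => by
    have h1 : Ideal.Quotient.mk w (τ • x) = Ideal.Quotient.mk w x ^ Nat.card (ℤ ⧸ w.under ℤ) := by
      rw [← map_pow, Ideal.Quotient.eq]
      exact hτ x
    rw [pow_succ, mul_smul, mk_pow_smul_of_isArithFrobAt hτ k (τ • x), h1, ← pow_mul, ← pow_succ']

/-- **At an unramified prime the order of an arithmetic Frobenius is the residue degree**
(Neukirch, *Algebraic Number Theory*, I (9.4); Washington Thm. 2.13): for `E/ℚ` finite Galois, a
prime `w` of `𝓞 E` with `e(w | ℤ) = 1` and `τ ∈ Gal(E/ℚ)` with `τ x ≡ x^p (mod w)`,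
`ord(τ) = f(w | ℤ)`. (`τ^k = 1` forces the `q^k`-power map to be trivial on `𝓞 E / w`, so `f ∣ k`;
and `τ^f` lies in the inertia group, which is trivial.) [folklore] -/
theorem orderOf_eq_inertiaDeg_of_isArithFrobAt [IsGalois ℚ E] {w : Ideal (𝓞 E)} [hw : w.IsMaximal]
    {τ : Gal(E/ℚ)} (hτ : IsArithFrobAt ℤ τ w) (he : w.ramificationIdx ℤ = 1) :
    orderOf τ = w.inertiaDeg ℤ := by
  haveI : IsGaloisGroup Gal(E/ℚ) ℤ (𝓞 E) := inferInstance
  set p₀ : Ideal ℤ := w.under ℤ with hp₀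
  haveI : p₀.IsMaximal := Ideal.IsMaximal.under ℤ w
  haveI : w.LiesOver p₀ := ⟨rfl⟩
  have hwne : w ≠ ⊥ := Ring.ne_bot_of_isMaximal_of_not_isField hw (RingOfIntegers.not_isField E)
  letI : Field (ℤ ⧸ p₀) := Ideal.Quotient.field _
  letI : Field (𝓞 E ⧸ w) := Ideal.Quotient.field _
  haveI : Finite (𝓞 E ⧸ w) := w.finiteQuotientOfFreeOfNeBot hwne
  haveI : Finite (ℤ ⧸ p₀) := AlgHom.IsArithFrobAt.finite_quotient hτ
  letI : Fintype (ℤ ⧸ p₀) := Fintype.ofFinite _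
  letI : Fintype (𝓞 E ⧸ w) := Fintype.ofFinite _
  set q := Nat.card (ℤ ⧸ p₀) with hq
  have hqcard : Fintype.card (ℤ ⧸ p₀) = q := Fintype.card_eq_nat_card
  have hf : w.inertiaDeg ℤ = Module.finrank (ℤ ⧸ p₀) (𝓞 E ⧸ w) := Ideal.inertiaDeg_eq_of_isMaximal p₀ w
  refine Nat.dvd_antisymm ?_ ?_
  · -- `τ^f ∈ I(w) = 1`
    refine orderOf_dvd_of_pow_eq_one ?_
    have hmem : τ ^ w.inertiaDeg ℤ ∈ w.inertia Gal(E/ℚ) := by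
      intro x
      change τ ^ w.inertiaDeg ℤ • x - x ∈ w
      rw [← Ideal.Quotient.eq, mk_pow_smul_of_isArithFrobAt hτ]
      have hcardE : Nat.card (𝓞 E ⧸ w) = q ^ w.inertiaDeg ℤ := by
        rw [hf, Module.natCard_eq_pow_finrank (K := ℤ ⧸ p₀)]
      change Ideal.Quotient.mk w x ^ q ^ w.inertiaDeg ℤ = _
      rw [← hcardE, Nat.card_eq_fintype_card, FiniteField.pow_card]
    have hI : w.inertia Gal(E/ℚ) = ⊥ := by
      refine Subgroup.eq_bot_of_card_eq _ ?_
      rw [Ideal.card_inertia_eq_ramificationIdxIn p₀ w (G := Gal(E/ℚ)),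
        Ideal.ramificationIdxIn_eq_ramificationIdx p₀ w Gal(E/ℚ), he]
    rw [hI, Subgroup.mem_bot] at hmem
    exact hmem
  · -- `τ^k = 1 ⇒ Frob_q^k = 1` on `𝓞 E / w`, and `Frob_q` has order `f`
    rw [hf, ← FiniteField.orderOf_frobeniusAlgHom (ℤ ⧸ p₀) (𝓞 E ⧸ w)]
    refine orderOf_dvd_of_pow_eq_one (DFunLike.ext _ _ fun x ↦ ?_)
    obtain ⟨x, rfl⟩ := Ideal.Quotient.mk_surjective x
    rw [AlgHom.coe_pow, FiniteField.coe_frobeniusAlgHom, pow_iterate, AlgHom.one_apply, hqcard]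
    change Ideal.Quotient.mk w x ^ q ^ orderOf τ = _
    rw [hq, ← mk_pow_smul_of_isArithFrobAt hτ, pow_orderOf_eq_one, one_smul]

end FrobeniusOrder

/-! ## Intermediate fields of `ℚ(ζ_m)`: the Frobenius `σ_p` and the residue degree -/

section Cyclotomic

open IsCyclotomicExtension.Rat

variable (m : ℕ) [NeZero m] (K : Type) [Field K] [NumberField K] [IsCyclotomicExtension {m} ℚ K]
  [IsGalois ℚ K] [IsMulCommutative Gal(K/ℚ)]
variable (p : ℕ) [hp : Fact p.Prime]

omit [IsGalois ℚ K] [IsMulCommutative Gal(K/ℚ)] in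
/-- **The Frobenius of `ℚ(ζ_m)` above `p ∤ m` is `σ_p : ζ ↦ ζ^p`**: an arithmetic Frobenius
`σ ∈ Gal(ℚ(ζ_m)/ℚ)` at a prime `P ∣ p` has `galEquivZMod σ = p` (it raises `ζ_m` to the `p`-th power,
Mathlib `AlgHom.IsArithFrobAt.apply_of_pow_eq_one`; Washington, proof of Thm. 2.13). [folklore] -/
theorem galEquivZMod_eq_of_isArithFrobAt (hpm : ¬ p ∣ m) (P : Ideal (𝓞 K)) [P.IsMaximal]
    [P.LiesOver (Ideal.span {(p : ℤ)})] {σ : Gal(K/ℚ)} (hσ : IsArithFrobAt ℤ σ P) :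
    galEquivZMod m K σ = ZMod.unitOfCoprime p (hp.out.coprime_iff_not_dvd.mpr hpm) := by
  have hcop : p.Coprime m := hp.out.coprime_iff_not_dvd.mpr hpm
  have hζ := IsCyclotomicExtension.zeta_spec m ℚ K
  have h₀ : IsPrimitiveRoot hζ.toInteger m := hζ.toInteger_isPrimitiveRoot
  have hmP : ((m : ℕ) : 𝓞 K) ∉ P := by
    intro h
    have h' : (m : ℤ) ∈ P.under ℤ := by
      rw [Ideal.under_def, Ideal.mem_comap, map_natCast]
      exact h
    rw [← Ideal.over_def P (Ideal.span {(p : ℤ)}), Ideal.mem_span_singleton] at h'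
    exact hpm (Int.natCast_dvd_natCast.mp h')
  have h1 := hσ.apply_of_pow_eq_one h₀.pow_eq_one hmP
  rw [MulSemiringAction.toAlgHom_apply, ← Ideal.over_def P (Ideal.span {(p : ℤ)}),
    Int.card_ideal_quot, galEquivZMod_smul_of_pow_eq m K σ h₀.pow_eq_one,
    (h₀.isOfFinOrder (NeZero.ne _)).pow_inj_mod, ← h₀.eq_orderOf] at h1
  ext
  rw [ZMod.coe_unitOfCoprime, ← ZMod.natCast_zmod_val ((galEquivZMod m K σ : (ZMod m)ˣ) : ZMod m)]
  exact (ZMod.natCast_eq_natCast_iff' _ _ m).mpr h1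

variable (H : Subgroup Gal(K/ℚ))

/-- **Decomposition of `p ∤ m` in `F = ℚ(ζ_m)^H`**: a prime `w` of `𝓞 F` above `p` is unramified
and its residue degree is the order of `σ_p H` in `Gal(ℚ(ζ_m)/ℚ)/H` (`σ_p : ζ ↦ ζ^p`): the
restriction of the Frobenius `σ_p` of a prime of `ℚ(ζ_m)` above `w` is an arithmetic Frobenius at
`w`, whose order is `f(w|p)` (Washington Thm. 2.13 and Ch. 3; Neukirch I (9.4)). [folklore] -/
theorem ramificationIdx_eq_one_and_inertiaDeg_eq_orderOf (hpm : ¬ p ∣ m)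
    (w : Ideal (𝓞 ↥(IntermediateField.fixedField H))) [hw : w.IsMaximal]
    [w.LiesOver (Ideal.span {(p : ℤ)})] :
    w.ramificationIdx ℤ = 1 ∧ w.inertiaDeg ℤ =
      orderOf (QuotientGroup.mk ((galEquivZMod m K).symm
        (ZMod.unitOfCoprime p (hp.out.coprime_iff_not_dvd.mpr hpm))) : Gal(K/ℚ) ⧸ H) := by
  haveI : IsGalois ℚ ↥(IntermediateField.fixedField H) := IsGalois.of_fixedField_normal_subgroup H
  have hwne : w ≠ ⊥ := Ring.ne_bot_of_isMaximal_of_not_isField hw (RingOfIntegers.not_isField ↥(IntermediateField.fixedField H))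
  -- a prime `Q` of `𝓞 K` above `w`
  obtain ⟨Q, hQmax, hQw⟩ := Ideal.exists_maximal_ideal_liesOver_of_isIntegral (S := 𝓞 K) w
  haveI := hQmax
  haveI := hQw
  haveI : Q.LiesOver (Ideal.span {(p : ℤ)}) := Ideal.LiesOver.trans Q w _
  have hQne : Q ≠ ⊥ := Ring.ne_bot_of_isMaximal_of_not_isField hQmax (RingOfIntegers.not_isField K)
  -- `e = 1`
  haveI : Algebra.IsUnramifiedAt ℤ Q :=
    Ideal.ramificationIdx_eq_one_iff.mp (ramificationIdx_eq_of_not_dvd p K Q hpm)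
  haveI : Algebra.IsUnramifiedAt ℤ w := Algebra.IsUnramifiedAt.of_liesOver ℤ w Q
  have he : w.ramificationIdx ℤ = 1 := Ideal.ramificationIdx_eq_one w ℤ
  refine ⟨he, ?_⟩
  -- the Frobenius of `K` at `Q` and its restriction to `F`
  haveI : Finite (𝓞 K ⧸ Q) := Q.finiteQuotientOfFreeOfNeBot hQne
  obtain ⟨σ, hσ⟩ := IsArithFrobAt.exists_of_isInvariant ℤ Gal(K/ℚ) Q
  have hσp := galEquivZMod_eq_of_isArithFrobAt m K p hpm Q hσ
  set τ : Gal(↥(IntermediateField.fixedField H)/ℚ) := AlgEquiv.restrictNormalHom ↥(IntermediateField.fixedField H) σ with hτdef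
  have hcoe : ∀ x : 𝓞 ↥(IntermediateField.fixedField H), ((algebraMap (𝓞 ↥(IntermediateField.fixedField H)) (𝓞 K) (τ • x) : 𝓞 K) : K) =
      ((σ • algebraMap (𝓞 ↥(IntermediateField.fixedField H)) (𝓞 K) x : 𝓞 K) : K) := by
    intro x
    change (((τ (x : ↥(IntermediateField.fixedField H))) : ↥(IntermediateField.fixedField H)) : K) = σ ((x : ↥(IntermediateField.fixedField H)) : K)
    exact AlgEquiv.restrictNormal_commutes σ ↥(IntermediateField.fixedField H) (x : ↥(IntermediateField.fixedField H))
  have hτ : IsArithFrobAt ℤ τ w := by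
    intro x
    rw [MulSemiringAction.toAlgHom_apply, ← Ideal.over_def w (Ideal.span {(p : ℤ)}),
      Ideal.over_def Q (Ideal.span {(p : ℤ)}), hQw.over, Ideal.under_def, Ideal.mem_comap, map_sub,
      map_pow]
    have h := hσ (algebraMap (𝓞 ↥(IntermediateField.fixedField H)) (𝓞 K) x)
    rw [MulSemiringAction.toAlgHom_apply] at h
    convert h using 2
    exact RingOfIntegers.coe_injective (hcoe x)
  -- orders
  have h1 : orderOf τ = w.inertiaDeg ℤ := orderOf_eq_inertiaDeg_of_isArithFrobAt hτ he
  have h2 : τ = (IsGalois.normalAutEquivQuotient H) (QuotientGroup.mk σ) := rfl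
  have h3 : orderOf τ = orderOf (QuotientGroup.mk σ : Gal(K/ℚ) ⧸ H) := by
    rw [h2]
    exact orderOf_injective (IsGalois.normalAutEquivQuotient H).toMonoidHom
      (IsGalois.normalAutEquivQuotient H).injective _
  have h4 : σ = (galEquivZMod m K).symm
      (ZMod.unitOfCoprime p (hp.out.coprime_iff_not_dvd.mpr hpm)) := by
    rw [← hσp, MulEquiv.symm_apply_apply]
  rw [← h1, h3, h4]

/-- **`#{w ∣ p} · f = [F : ℚ]`** for `F = ℚ(ζ_m)^H` and `p ∤ m`: with `e = 1` and all residue degrees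
equal to the order `n` of `σ_p H`, the fundamental identity `∑ e f = [F : ℚ] = #(Gal(ℚ(ζ_m)/ℚ)/H)`
reads `#{w ∣ p} · n = #(Gal/H)` (Mathlib `Ideal.ncard_primesOver_mul_ramificationIdxIn_mul_inertiaDegIn`).
[folklore] -/
theorem ncard_primesOver_mul_orderOf (hpm : ¬ p ∣ m) :
    ((Ideal.span {(p : ℤ)}).primesOver (𝓞 ↥(IntermediateField.fixedField H))).ncard *
      orderOf (QuotientGroup.mk ((galEquivZMod m K).symm
        (ZMod.unitOfCoprime p (hp.out.coprime_iff_not_dvd.mpr hpm))) : Gal(K/ℚ) ⧸ H) =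
      Nat.card (Gal(K/ℚ) ⧸ H) := by
  haveI : IsGalois ℚ ↥(IntermediateField.fixedField H) := IsGalois.of_fixedField_normal_subgroup H
  haveI : IsGaloisGroup Gal(↥(IntermediateField.fixedField H)/ℚ) ℤ (𝓞 ↥(IntermediateField.fixedField H)) := inferInstance
  haveI : (Ideal.span {(p : ℤ)}).IsMaximal :=
    ((Ideal.span_singleton_prime (by exact_mod_cast hp.out.ne_zero)).mpr
      (Nat.prime_iff_prime_int.mp hp.out)).isMaximal (by simpa using hp.out.ne_zero)
  obtain ⟨w, hwmax, hwp⟩ :=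
    Ideal.exists_maximal_ideal_liesOver_of_isIntegral (S := 𝓞 ↥(IntermediateField.fixedField H)) (Ideal.span {(p : ℤ)})
  haveI := hwmax
  haveI := hwp
  obtain ⟨he, hf⟩ := ramificationIdx_eq_one_and_inertiaDeg_eq_orderOf m K p H hpm w
  have key := Ideal.ncard_primesOver_mul_ramificationIdxIn_mul_inertiaDegIn (Ideal.span {(p : ℤ)})
    (𝓞 ↥(IntermediateField.fixedField H)) Gal(↥(IntermediateField.fixedField H)/ℚ)
  rw [Ideal.ramificationIdxIn_eq_ramificationIdx (Ideal.span {(p : ℤ)}) w Gal(↥(IntermediateField.fixedField H)/ℚ),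
    Ideal.inertiaDegIn_eq_inertiaDeg (Ideal.span {(p : ℤ)}) w Gal(↥(IntermediateField.fixedField H)/ℚ), he, hf, one_mul]
    at key
  refine key.trans ?_
  convert (Nat.card_congr (IsGalois.normalAutEquivQuotient H).toEquiv).symm using 1
  congr!


/-- A maximal ideal of a ring of integers containing the rational prime `p` lies over `pℤ`.
[folklore] -/
theorem liesOver_span_of_natCast_mem {L : Type*} [Field L] [NumberField L] (P : Ideal (𝓞 L))
    [P.IsMaximal] (hpP : (p : 𝓞 L) ∈ P) : P.LiesOver (Ideal.span {(p : ℤ)}) := by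
  haveI : (Ideal.span {(p : ℤ)}).IsMaximal :=
    ((Ideal.span_singleton_prime (by exact_mod_cast hp.out.ne_zero)).mpr
      (Nat.prime_iff_prime_int.mp hp.out)).isMaximal (by simpa using hp.out.ne_zero)
  refine ⟨Ideal.IsMaximal.eq_of_le inferInstance (Ideal.IsMaximal.under ℤ P).ne_top ?_⟩
  rw [Ideal.span_singleton_le_iff_mem, Ideal.under_def, Ideal.mem_comap, map_natCast]
  exact hpP

/-- **Places of `F = ℚ(ζ_m)^H` above `p ∤ m`, in the tree's conventions** (base `𝓞 ℚ`, finite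
places as `HeightOneSpectrum`): every place `w` of `F` above the place `v ∋ p` of `ℚ` has
`e(w|v) = 1` and `f(w|v) = n`, the order of `σ_p H` in `Gal(ℚ(ζ_m)/ℚ)/H`. [folklore] -/
theorem ramificationIdx_eq_one_and_inertiaDeg_eq_orderOf' (hpm : ¬ p ∣ m)
    {v : HeightOneSpectrum (𝓞 ℚ)} (hv : (p : 𝓞 ℚ) ∈ v.asIdeal)
    (w : HeightOneSpectrum (𝓞 ↥(IntermediateField.fixedField H)))
    (hw : w.asIdeal.under (𝓞 ℚ) = v.asIdeal) :
    w.asIdeal.ramificationIdx (𝓞 ℚ) = 1 ∧ w.asIdeal.inertiaDeg (𝓞 ℚ) =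
      orderOf (QuotientGroup.mk ((galEquivZMod m K).symm
        (ZMod.unitOfCoprime p (hp.out.coprime_iff_not_dvd.mpr hpm))) : Gal(K/ℚ) ⧸ H) := by
  haveI : w.asIdeal.IsMaximal := w.isMaximal
  have hpw : (p : 𝓞 ↥(IntermediateField.fixedField H)) ∈ w.asIdeal := by
    have h : algebraMap (𝓞 ℚ) (𝓞 ↥(IntermediateField.fixedField H)) (p : 𝓞 ℚ) ∈ w.asIdeal := by
      rw [← Ideal.mem_comap, ← Ideal.under_def, hw]
      exact hv
    rwa [map_natCast] at h
  haveI := liesOver_span_of_natCast_mem p w.asIdeal hpw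
  rw [ramificationIdx_ringOfIntegersRat_eq, inertiaDeg_ringOfIntegersRat_eq]
  exact ramificationIdx_eq_one_and_inertiaDeg_eq_orderOf m K p H hpm w.asIdeal

/-- **`#{w ∣ v} · n = #(Gal(ℚ(ζ_m)/ℚ)/H)`** in the tree's conventions: the places `w` of
`F = ℚ(ζ_m)^H` with `w ∩ 𝓞 ℚ = v` (`v ∋ p`, `p ∤ m`) are the primes of `𝓞 F` above `pℤ`.
[folklore] -/
theorem ncard_setOf_under_eq_mul_orderOf (hpm : ¬ p ∣ m)
    {v : HeightOneSpectrum (𝓞 ℚ)} (hv : (p : 𝓞 ℚ) ∈ v.asIdeal) :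
    {w : HeightOneSpectrum (𝓞 ↥(IntermediateField.fixedField H)) |
        w.asIdeal.under (𝓞 ℚ) = v.asIdeal}.ncard *
      orderOf (QuotientGroup.mk ((galEquivZMod m K).symm
        (ZMod.unitOfCoprime p (hp.out.coprime_iff_not_dvd.mpr hpm))) : Gal(K/ℚ) ⧸ H) =
      Nat.card (Gal(K/ℚ) ⧸ H) := by
  rw [← ncard_primesOver_mul_orderOf m K p H hpm]
  congr 1
  refine Set.ncard_congr (fun w _ ↦ w.asIdeal) (fun w hw ↦ ?_) (fun w w' _ _ h ↦ HeightOneSpectrum.ext h)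
    (fun P hP ↦ ?_)
  · haveI : w.asIdeal.IsMaximal := w.isMaximal
    have hpw : (p : 𝓞 ↥(IntermediateField.fixedField H)) ∈ w.asIdeal := by
      have h : algebraMap (𝓞 ℚ) (𝓞 ↥(IntermediateField.fixedField H)) (p : 𝓞 ℚ) ∈ w.asIdeal := by
        rw [← Ideal.mem_comap, ← Ideal.under_def, hw]
        exact hv
      rwa [map_natCast] at h
    exact ⟨w.isPrime, liesOver_span_of_natCast_mem p w.asIdeal hpw⟩
  · obtain ⟨hPprime, hPover⟩ := hP
    have hPne : P ≠ ⊥ := by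
      intro h
      rw [h] at hPover
      have h1 : (p : ℤ) ∈ (⊥ : Ideal (𝓞 ↥(IntermediateField.fixedField H))).under ℤ := by
        rw [← hPover.over]
        exact Ideal.mem_span_singleton_self _
      rw [Ideal.under_def, Ideal.mem_comap, map_natCast, Ideal.mem_bot] at h1
      exact hp.out.ne_zero (by exact_mod_cast h1)
    refine ⟨⟨P, hPprime, hPne⟩, ?_, rfl⟩
    set v' : HeightOneSpectrum (𝓞 ℚ) := ⟨P.under (𝓞 ℚ), Ideal.IsPrime.under (𝓞 ℚ) P,
      Ideal.under_ne_bot (A := 𝓞 ℚ) hPne⟩ with hv'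
    have hpv' : (p : 𝓞 ℚ) ∈ v'.asIdeal := by
      change (p : 𝓞 ℚ) ∈ P.under (𝓞 ℚ)
      rw [Ideal.under_def, Ideal.mem_comap, map_natCast]
      have h1 : algebraMap ℤ (𝓞 ↥(IntermediateField.fixedField H)) (p : ℤ) ∈ P :=
        (Ideal.mem_of_liesOver P (Ideal.span {(p : ℤ)}) (p : ℤ)).mp (Ideal.mem_span_singleton_self _)
      simpa using h1
    have := HeightOneSpectrum.eq_of_natCast_mem hp.out hv hpv'
    change P.under (𝓞 ℚ) = v.asIdeal
    exact congrArg HeightOneSpectrum.asIdeal this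

end Cyclotomic

end Summit.BirchSwinnertonDyer.BirchSwinnertonDyer.Theorems

end
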